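import Mathlib.Combinatorics.SetFamily.FourFunctions
import Mathlib.Tactic
import HarnessLib
import HarnessLib.Audit.Tags
import Summits.CriticalPhenomena.PercolationContinuityZ3.Theorems.PercNearOneGluingNoHeavyLowerTailSahiRainbowTwoColourTwins

/-!
# The Marica–Schönheim slack is monotone under traces

Support file (seat `prim-masterthm-p1`, gen 44; `--supports stmt-CriticalPhenomena-4575`).  Theorems only; no `sorry`, standard axioms.
Memo `run/shared/lean/prim/prim-masterthm/FROM-prim-masterthm-p1-g44-MEMBER-FACE.md` §5(b).

For a finite family `𝒜` of finite sets write `ms(𝒜) := #(𝒜 \\ 𝒜) − #𝒜 ≥ 0` (Marica–Schönheim, Mathlib's `Finset.card_le_card_diffs`).  THEOREM ([this work];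
the one-point case is the classical compression proof of Marica–Schönheim read as a monotonicity statement):
**`ms` does not increase under taking traces** — for every `Y`, the trace family `𝒜|_{∁Y} = 𝒜.image (· \ Y)` satisfies
`#(𝒜|_{∁Y} \\ 𝒜|_{∁Y}) + #𝒜 ≤ #(𝒜 \\ 𝒜) + #𝒜|_{∁Y}` (`card_diffs_image_sdiff_add_card_le`).
One point `y` (`card_diffs_image_erase_add_card_le`): `#𝒜 = #𝒜.image(erase y) + #D` with `D = bothLifts 𝒜 y` the doubled members (`d, insert y d ∈ 𝒜`),
`#(𝒜 \\ 𝒜) = #(𝒜 \\ 𝒜).image(erase y) + #twins` (the same fibre count for the difference family), the differences project onto the differences of the projection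
EXACTLY (`image_erase_diffs`), and **every difference of two doubled members is a twin** (`diffs_bothLifts_subset_bothLifts_diffs`: `d \ d'` and
`insert y d \ d' = insert y (d \ d')` are both differences); Marica–Schönheim for `D` gives `#twins ≥ #(D \\ D) ≥ #D`.
WHY IT IS HERE.  In the Z-language of `PartitionSignedDaykin` (`…SahiTypeSetDaykin`), ONE label means `typeMeets = P \\ P`, and the member-face quantity of
`…SahiTypeSetDaykinBlock` (`Φ(p) = (slack Z − slack Z^{(p)})/2`, conjecture `CrossMemberFace`) is exactly `ms(P) − ms(P|_{∁p})`; with two labels the same holds for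
`Q = P₀ ∪ σP₁`.  So this file is the ≤ 2-label case of the member-face phenomenon, where EVERY compression step is good for EVERY family — the mechanism
(twins ⊇ differences of the doubled family) that the 3-label case must generalise (memo §5–§6).  HONEST FRAMING: unconditional elementary theorems; nothing about the
open 3-label conjectures is claimed. [this work]
-/

namespace Summit.CriticalPhenomena.PercolationContinuityZ3.Theorems.SahiColouredDaykin

open Finset
open scoped FinsetFamily

variable {α : Type*} [DecidableEq α]

/-- Erasing a point commutes with set difference. [folklore] -/
theorem erase_sdiff_erase (a b : Finset α) (y : α) : (a \ b).erase y = a.erase y \ b.erase y := by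
  ext t; simp only [mem_erase, mem_sdiff]; tauto

/-- Removing a block commutes with set difference. [folklore] -/
theorem sdiff_sdiff_sdiff_right (a b Y : Finset α) : (a \ b) \ Y = (a \ Y) \ (b \ Y) := by
  ext t; simp only [mem_sdiff]; tauto

/-- **Exact projection of the difference family**: `(𝒜 \\ 𝒜).image (erase y) = 𝒜.image (erase y) \\ 𝒜.image (erase y)`. [this work] -/
theorem image_erase_diffs (𝒜 : Finset (Finset α)) (y : α) :
    (𝒜 \\ 𝒜).image (fun s => s.erase y) = (𝒜.image fun s => s.erase y) \\ (𝒜.image fun s => s.erase y) := by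
  ext w
  simp only [mem_image, mem_diffs]
  constructor
  · rintro ⟨d, ⟨a, ha, b, hb, rfl⟩, rfl⟩
    exact ⟨a.erase y, ⟨a, ha, rfl⟩, b.erase y, ⟨b, hb, rfl⟩, (erase_sdiff_erase a b y).symm⟩
  · rintro ⟨a', ⟨a, ha, rfl⟩, b', ⟨b, hb, rfl⟩, rfl⟩
    exact ⟨a \ b, ⟨a, ha, b, hb, rfl⟩, erase_sdiff_erase a b y⟩

/-- The same for a block `Y`. [this work] -/
theorem image_sdiff_diffs (𝒜 : Finset (Finset α)) (Y : Finset α) :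
    (𝒜 \\ 𝒜).image (fun s => s \ Y) = (𝒜.image fun s => s \ Y) \\ (𝒜.image fun s => s \ Y) := by
  ext w
  simp only [mem_image, mem_diffs]
  constructor
  · rintro ⟨d, ⟨a, ha, b, hb, rfl⟩, rfl⟩
    exact ⟨a \ Y, ⟨a, ha, rfl⟩, b \ Y, ⟨b, hb, rfl⟩, (sdiff_sdiff_sdiff_right a b Y).symm⟩
  · rintro ⟨a', ⟨a, ha, rfl⟩, b', ⟨b, hb, rfl⟩, rfl⟩
    exact ⟨a \ b, ⟨a, ha, b, hb, rfl⟩, sdiff_sdiff_sdiff_right a b Y⟩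

/-- **Differences of doubled members are twins of the difference family.** [this work] -/
theorem diffs_bothLifts_subset_bothLifts_diffs (𝒜 : Finset (Finset α)) (y : α) :
    (bothLifts 𝒜 y) \\ (bothLifts 𝒜 y) ⊆ bothLifts (𝒜 \\ 𝒜) y := by
  intro d hd
  obtain ⟨a, ha, b, hb, rfl⟩ := mem_diffs.1 hd
  obtain ⟨hya, haA, hyaA⟩ := mem_bothLifts.1 ha
  obtain ⟨hyb, hbA, _⟩ := mem_bothLifts.1 hb
  refine mem_bothLifts.2 ⟨fun h => hya (mem_sdiff.1 h).1, mem_diffs.2 ⟨a, haA, b, hbA, rfl⟩, ?_⟩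
  refine mem_diffs.2 ⟨insert y a, hyaA, b, hbA, ?_⟩
  ext t
  simp only [mem_sdiff, mem_insert]
  constructor
  · rintro ⟨rfl | hta, htb⟩
    · exact Or.inl rfl
    · exact Or.inr ⟨hta, htb⟩
  · rintro (rfl | ⟨hta, htb⟩)
    · exact ⟨Or.inl rfl, hyb⟩
    · exact ⟨Or.inr hta, htb⟩

/-- **MS-slack is monotone under erasing a point**: `#(𝒜_y \\ 𝒜_y) + #𝒜 ≤ #(𝒜 \\ 𝒜) + #𝒜_y` with `𝒜_y = 𝒜.image (erase y)`. [this work] -/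
theorem card_diffs_image_erase_add_card_le (𝒜 : Finset (Finset α)) (y : α) :
    #((𝒜.image fun s => s.erase y) \\ (𝒜.image fun s => s.erase y)) + #𝒜 ≤
      #(𝒜 \\ 𝒜) + #(𝒜.image fun s => s.erase y) := by
  have h1 := card_image_erase_add_card_bothLifts (𝒜 \\ 𝒜) y
  have h2 := card_image_erase_add_card_bothLifts 𝒜 y
  have h3 : #(bothLifts 𝒜 y) ≤ #(bothLifts (𝒜 \\ 𝒜) y) :=
    (Finset.card_le_card_diffs (bothLifts 𝒜 y)).trans (card_le_card (diffs_bothLifts_subset_bothLifts_diffs 𝒜 y))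
  rw [image_erase_diffs] at h1
  omega

/-- **MS-slack is monotone under traces**: for every block `Y`, `#(𝒜|_{∁Y} \\ 𝒜|_{∁Y}) + #𝒜 ≤ #(𝒜 \\ 𝒜) + #𝒜|_{∁Y}` where
`𝒜|_{∁Y} = 𝒜.image (· \ Y)`.  In particular (with `Finset.card_le_card_diffs` for the trace family) Marica–Schönheim for `𝒜` with the slack of any of its
trace families to spare. [this work] -/
theorem card_diffs_image_sdiff_add_card_le (𝒜 : Finset (Finset α)) (Y : Finset α) :
    #((𝒜.image fun s => s \ Y) \\ (𝒜.image fun s => s \ Y)) + #𝒜 ≤ #(𝒜 \\ 𝒜) + #(𝒜.image fun s => s \ Y) := by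
  induction Y using Finset.induction_on with
  | empty => simp only [sdiff_empty, image_id', le_refl]
  | insert y Y _ ih =>
    have e : (𝒜.image fun s => s \ insert y Y) = (𝒜.image fun s => s \ Y).image fun s => s.erase y := by
      rw [image_image]
      refine image_congr fun s _ => ?_
      simp only [Function.comp_apply, sdiff_insert]
    rw [e]
    have step := card_diffs_image_erase_add_card_le (𝒜.image fun s => s \ Y) y
    omega

/-- The slack form: `ms(𝒜|_{∁Y}) ≤ ms(𝒜)` with `ms(ℬ) = #(ℬ \\ ℬ) − #ℬ` (natural subtraction is exact by Marica–Schönheim). [this work] -/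
theorem card_diffs_sub_card_image_sdiff_le (𝒜 : Finset (Finset α)) (Y : Finset α) :
    #((𝒜.image fun s => s \ Y) \\ (𝒜.image fun s => s \ Y)) - #(𝒜.image fun s => s \ Y) ≤ #(𝒜 \\ 𝒜) - #𝒜 := by
  have h := card_diffs_image_sdiff_add_card_le 𝒜 Y
  have h1 := Finset.card_le_card_diffs 𝒜
  have h2 := Finset.card_le_card_diffs (𝒜.image fun s => s \ Y)
  omega

end Summit.CriticalPhenomena.PercolationContinuityZ3.Theorems.SahiColouredDaykin
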